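import Literature.AnabelianGeometry.EtaleTheta.Discharge.Sec5OriginClausesOfPushforward
import Literature.AnabelianGeometry.EtaleTheta.Discharge.Sec4GaloisSurjLawsConnectedModel
import HarnessLib

/-!
# [FrdII] Def 2.2 (i) at `D₀ = B^temp(Π₁)⁰ → E = B^temp(Π₂)⁰`: the outer homomorphism `Π₂ ↠ Aut_E(φ_* A)`

[MochizukiFrdII2008] S. Mochizuki, *The geometry of Frobenioids II*, Kyushu J. Math. 62 (2008), Def 2.2 (i) p.17 and
Ex 1.3 (ii) p.11; [MochizukiEtTh2009] S. Mochizuki, *The étale theta function …*, Publ. RIMS 45 (2009), Thm 4.4 (iii)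
p.95 («`(N, H)`-saturated … cf. [FrdII], Definition 2.2, (ii)»), §5 p.298 (the natural functor `D₀ → D^cnst`
determined by `Π^tp_X ↠ G_K`).

[FrdII] Def 2.2 (i) needs, for a Galois object `A` of the base category whose image `A_E` in `E = B(G)⁰` is taken along
the base-field functor, «the natural OUTER homomorphism `G ↠ G_A := Aut_E(A_E)`» — an open surjection.  For the functor
`φ_* : B^temp(Π₁)⁰ → B^temp(Π₂)⁰` of [FrdII] Ex 1.3 (ii) (abc-iut-L3's `QuasiTemperoid.pushforward`, `φ : Π₁ ↠ Π₂` open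
surjective; the case of record is `φ = (Π^tp_X ↠ G_K)`, abc-iut-w4-d008's `Sec5OriginClausesOfPushforward`) this file
PROVES the existence of a representative (proof-only, no `def`; a later definition may `Classical.choose` it):

* `mapAut_pushforward_galoisSurjOf_of_ker` — `φ_*(galoisSurjOf⁰_A(δ)) = 1` in `Aut(φ_* A)` for `δ ∈ Ker φ`
  (abc-iut-w4-d008's `pushforward_map_galoisSurjOf_of_ker` read in `Aut`);
* `exists_pushforwardOuterRep` — **∃ `ρ_A : Π₂ →* Aut_{B^temp(Π₂)⁰}(φ_* A)` with `ρ_A (φ g) = φ_*(galoisSurjOf⁰_A(g))`,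
  `ρ_A` SURJECTIVE and `Ker ρ_A` OPEN** — the three fields `outer` / `outer_surjective` / `isOpen_ker_outer` of
  abc-iut-L1-d4's `PadicKummer.Def22Context` at `A_E := φ_* A`;
* `pushforwardOuterRep_unique` — the intertwining clause determines `ρ_A` (`φ` surjective).

The representative depends on abc-iut-w5-d013's chosen presentation `A ≅ Π₁/N_A` (`galoisSurjOf`): changing it
conjugates `ρ_A` — [FrdII] Def 2.2 (i) «up to composition with an inner automorphism», cf. abc-iut-w6-d047's
`BiKummerThm44SubNHSatDef22Conj.lean`.
-/

namespace Literature.AnabelianGeometry.EtaleTheta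

open CategoryTheory Opposite Literature.AlgebraicGeometry.Frobenioids Literature.AlgebraicGeometry.Frobenioids.QuasiTemperoid
  Literature.AnabelianGeometry.SemiGraphs Literature.AnabelianGeometry.SemiGraphs.GaloisObjects

universe u

namespace CnstPushforward

variable {G₁ : Type u} [Group G₁] [TopologicalSpace G₁] [IsTopologicalGroup G₁] {G₂ : Type u} [Group G₂]
  [TopologicalSpace G₂] (φ : G₁ →* G₂) (hs : Function.Surjective φ) (hφ : IsOpenMap φ)

/-- **`φ_*(galoisSurjOf⁰_A(δ)) = 1` in `Aut_{B^temp(Π₂)⁰}(φ_* A)` for `δ ∈ Ker(φ)`** — geometric automorphisms of the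
Galois object `A` die under `φ_*` ([FrdII] Ex 1.3 (ii); abc-iut-w4-d008's `pushforward_map_galoisSurjOf_of_ker` read
through `Functor.mapAut` and the transport `Aut(A.obj) ≃* Aut(A)` of the full subcategory `B^temp(Π₁)⁰`).
[cite: MochizukiFrdII2008, Ex 1.3 (ii) p.11] -/
theorem mapAut_pushforward_galoisSurjOf_of_ker (hG : IsTempered G₁) (A : ConnectedPart (BTemp G₁))
    (hA : IsGaloisObj A.obj) {δ : G₁} (hδ : φ δ = 1) :
    (pushforward φ hs hφ).mapAut A
      (((connectedObjects (BTemp G₁)).fullyFaithfulι.autMulEquivOfFullyFaithful A).symm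
        (galoisSurjOf hG A.obj hA δ)) = 1 := by
  apply Iso.ext
  change (pushforward φ hs hφ).map (ObjectProperty.homMk (galoisSurjOf hG A.obj hA δ).hom : A ⟶ A) = 𝟙 _
  exact pushforward_map_galoisSurjOf_of_ker φ hs hφ hG A hA hδ

/-- **[FrdII] Def 2.2 (i) «the natural outer homomorphism `G ↠ G_A ⊆ Aut_E(A_E)`» for `E`-images taken along
`φ_* : B^temp(Π₁)⁰ → B^temp(Π₂)⁰`, EXISTENCE OF A REPRESENTATIVE**: for a Galois object `A` of `B^temp(Π₁)⁰` there is a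
homomorphism `ρ_A : Π₂ → Aut_{B^temp(Π₂)⁰}(φ_* A)` with `ρ_A(φ g) = φ_*(galoisSurjOf⁰_A(g))` (descent of
`φ_* ∘ galoisSurjOf⁰_A` through `φ`, possible since `Ker φ` acts trivially after `φ_*`), which is SURJECTIVE (every
automorphism of the connected `Π₂`-set `A/Ker(φ)` is determined by the image of the class of the base point `x_A`, and
`[a·x_A] = φ_*(galoisSurjOf⁰_A(a⁻¹))[x_A]`) and has OPEN kernel (`Ker ρ_A = φ(Ker(φ_* ∘ galoisSurjOf⁰_A)) ⊇ φ(N_A)`,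
`φ` open).  These are the fields `outer`, `outer_surjective`, `isOpen_ker_outer` of a [FrdII] Def 2.2 context at
`A_E := φ_* A`. [cite: MochizukiFrdII2008, Def 2.2 (i) p.17] -/
theorem exists_pushforwardOuterRep (hG : IsTempered G₁) (A : ConnectedPart (BTemp G₁)) (hA : IsGaloisObj A.obj) :
    ∃ ρ : G₂ →* Aut ((pushforward φ hs hφ).obj A),
      (∀ g : G₁, ρ (φ g) = (pushforward φ hs hφ).mapAut A
        (((connectedObjects (BTemp G₁)).fullyFaithfulι.autMulEquivOfFullyFaithful A).symm
          (galoisSurjOf hG A.obj hA g))) ∧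
      Function.Surjective ρ ∧ IsOpen (ρ.ker : Set G₂) := by
  -- the homomorphism `φ_* ∘ galoisSurjOf⁰_A : Π₁ → Aut(φ_* A)` to be descended
  let ψ : G₁ →* Aut ((pushforward φ hs hφ).obj A) :=
    ((pushforward φ hs hφ).mapAut A).comp
      ((((connectedObjects (BTemp G₁)).fullyFaithfulι.autMulEquivOfFullyFaithful A).symm.toMonoidHom.comp
        (galoisSurjOf hG A.obj hA)))
  have hψ : ∀ g : G₁, ψ g = (pushforward φ hs hφ).mapAut A
      (((connectedObjects (BTemp G₁)).fullyFaithfulι.autMulEquivOfFullyFaithful A).symm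
        (galoisSurjOf hG A.obj hA g)) := fun g => rfl
  have hker : φ.ker ≤ ψ.ker := fun δ hδ => by
    rw [MonoidHom.mem_ker] at hδ ⊢
    rw [hψ]
    exact mapAut_pushforward_galoisSurjOf_of_ker φ hs hφ hG A hA hδ
  -- the descent through the surjection `φ`
  let ρ : G₂ →* Aut ((pushforward φ hs hφ).obj A) := φ.liftOfSurjective hs ⟨ψ, hker⟩
  have hρ : ∀ g : G₁, ρ (φ g) = ψ g := fun g => φ.liftOfRightInverse_comp_apply _ _ ⟨ψ, hker⟩ g
  refine ⟨ρ, fun g => (hρ g).trans (hψ g), ?_, ?_⟩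
  · -- surjectivity: match the image of the class of the base point
    intro σ
    obtain ⟨y, hy⟩ := orbitMk_surjective (φ := φ) A.obj
      (σ.hom.hom.hom.hom (orbitMk (galoisBase hG A.obj hA) : OrbitSet φ A.obj))
    obtain ⟨a, rfl⟩ := exists_ρ_galoisBase_eq hG A.obj hA y
    refine ⟨φ a⁻¹, ?_⟩
    rw [hρ, hψ]
    refine Iso.ext (ObjectProperty.hom_ext _ (BTempConnected.hom_eq_of_apply_eq ((pushforward φ hs hφ).obj A).property
      _ _ (orbitMk (galoisBase hG A.obj hA) : OrbitSet φ A.obj) ?_))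
    change (orbitMk ((galoisSurjOf hG A.obj hA a⁻¹).hom.hom.hom (galoisBase hG A.obj hA)) : OrbitSet φ A.obj) = _
    rw [galoisSurjOf_apply_base, inv_inv, hy]
  · -- open kernel: `Ker ρ = φ(Ker ψ)` and `Ker ψ ⊇ N_A` is open in `Π₁`
    have hN : (galoisSurjOf hG A.obj hA).ker ≤ ψ.ker := fun n hn => by
      rw [← ker_galoisSurjOf_connectedPart hG A hA, MonoidHom.mem_ker] at hn
      have hn' : ((connectedObjects (BTemp G₁)).fullyFaithfulι.autMulEquivOfFullyFaithful A).symm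
          (galoisSurjOf hG A.obj hA n) = 1 := hn
      rw [MonoidHom.mem_ker, hψ, hn', map_one]
    have hψo : IsOpen (ψ.ker : Set G₁) := Subgroup.isOpen_mono hN (isOpen_ker_galoisSurjOf hG A.obj hA)
    have hεq : (ρ.ker : Set G₂) = φ '' (ψ.ker : Set G₁) := by
      ext x
      constructor
      · intro hx
        obtain ⟨g, rfl⟩ := hs x
        refine ⟨g, ?_, rfl⟩
        rw [SetLike.mem_coe, MonoidHom.mem_ker] at hx ⊢
        rwa [← hρ]
      · rintro ⟨g, hg, rfl⟩
        rw [SetLike.mem_coe, MonoidHom.mem_ker] at hg ⊢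
        rwa [hρ]
    rw [hεq]
    exact hφ _ hψo

/-- **The representative is determined by the intertwining clause** (`φ` surjective): two homomorphisms
`Π₂ → Aut(φ_* A)` with `ρ(φ g) = φ_*(galoisSurjOf⁰_A(g))` for all `g` coincide. [cite: MochizukiFrdII2008, Def 2.2 (i) p.17] -/
theorem pushforwardOuterRep_unique (hG : IsTempered G₁) (A : ConnectedPart (BTemp G₁)) (hA : IsGaloisObj A.obj)
    {ρ ρ' : G₂ →* Aut ((pushforward φ hs hφ).obj A)}
    (hρ : ∀ g : G₁, ρ (φ g) = (pushforward φ hs hφ).mapAut A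
      (((connectedObjects (BTemp G₁)).fullyFaithfulι.autMulEquivOfFullyFaithful A).symm (galoisSurjOf hG A.obj hA g)))
    (hρ' : ∀ g : G₁, ρ' (φ g) = (pushforward φ hs hφ).mapAut A
      (((connectedObjects (BTemp G₁)).fullyFaithfulι.autMulEquivOfFullyFaithful A).symm (galoisSurjOf hG A.obj hA g))) :
    ρ = ρ' := by
  ext x
  obtain ⟨g, rfl⟩ := hs x
  rw [hρ, hρ']

end CnstPushforward

end Literature.AnabelianGeometry.EtaleTheta
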